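import Mathlib.MeasureTheory.Measure.Lebesgue.VolumeOfBalls
import Mathlib.MeasureTheory.Measure.Haar.InnerProductSpace
import Mathlib.MeasureTheory.Measure.Lebesgue.EqHaar
import Mathlib.LinearAlgebra.Determinant
import Mathlib.Topology.Instances.Matrix
import HarnessLib

/-!
# Integer points whose cells lie in a swept ellipse: `|det A| · #T ≤ κ π ρ² + 2 ρ R`

HONEST FRAMING. Part of the venture `Summits/Ventures/Crystal3D` (cell `crystal3d-full`), helper for the
crux `TextureLiminf` (stmt-Ventures-19483) of `route-Ventures-StickyWulffConstant`, line `TexShadow`, item n0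
of the coordinator (`affineSampleDeficit_upper_unif`: the clamped-slab deficit bound with a constant UNIFORM in
the grain orientation).  The non-uniformity of the existing bound (`lineCount_upper_offset_window`, constant
`∝ 1/|⟪W, ν⟫|`) comes from counting the bond lines of a class `W` by their crossings with the plane `ν^⊥`.
The uniform count projects the lines instead onto their OWN orthogonal plane `W^⊥`: there the line lattice
is a fixed lattice of covolume `1/√2` with cells of diameter `≤ 2`, and the shadow of the slab sample
`{lateral ≤ ρ, height ∈ [lo, lo + R]}` is an ellipse with semi-axes `ρ, |⟪W, ν⟫| ρ` swept along a segment of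
length `R √(1 - ⟪W, ν⟫²)`.  This file is the planar geometry-of-numbers half of that argument; nothing about
packings or lattices in `ℝ³`.

**Theorem 1** (`card_mul_det_le_volume_of_cells_subset`).  `A` a real `2 × 2` matrix with `det A ≠ 0`,
`b ∈ ℝ²`, `T ⊆ ℤ²` finite, `S ⊆ ℝ²`; if every half-open cell `A (z + [0,1)²) + b`, `z ∈ T`, lies in `S`, then
`#T · |det A| ≤ vol S`.  (The cells are pairwise disjoint of volume `|det A|`; proof copied from
`affine_disc_count_upper`.)

**Theorem 2** (`volume_sweptEllipse_le`).  For `κ > 0`, `s' ≥ 0`, `ρ, R ≥ 0` the swept ellipse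
`S = {y : ∃ h ∈ [lo, lo + R], κ² y₀² + (y₁ - h s')² ≤ κ² ρ²}` has `vol S ≤ κ π ρ² + 2 ρ R s'`:
`S` is covered by the lower half of the ellipse at `h = lo`, the upper half at `h = lo + R`, and the rectangle
`[-ρ, ρ] × [lo s', (lo + R) s']`; the two half ellipses are preimages of complementary half discs of radius
`κ ρ` under `diag(κ, 1)`.

**Theorem 3** (`affine_sweptEllipse_count_upper`) combines the two (with `s' ≤ 1`):
`|det A| · #T ≤ κ π ρ² + 2 ρ R`.

WHAT THIS IS NOT: the `ℝ³ → W^⊥` projection and the uniform line count are assembled elsewhere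
(`…GenericWallFloorLineCountUniform.lean`); no packing statement is touched here.
-/

noncomputable section

namespace Summit.Ventures.Crystal3D.Theorems

open MeasureTheory Set Finset

/-- **Cells inside a region.**  For a real `2 × 2` matrix `A` with `det A ≠ 0`, `b : Fin 2 → ℝ`, a finite
`T ⊆ ℤ²` and a set `S`, if `A (z + f) + b ∈ S` for every `z ∈ T` and every `f ∈ [0,1)²`, then
`#T · |det A| ≤ vol S` (the half-open parallelograms are pairwise disjoint of volume `|det A|`). -/
theorem card_mul_det_le_volume_of_cells_subset (A : Matrix (Fin 2) (Fin 2) ℝ) (hA : A.det ≠ 0)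
    (b : Fin 2 → ℝ) (S : Set (Fin 2 → ℝ)) (T : Finset (ℤ × ℤ))
    (hT : ∀ p ∈ T, ∀ f : Fin 2 → ℝ, (∀ m, 0 ≤ f m ∧ f m < 1) →
      A.mulVec (![(p.1 : ℝ), (p.2 : ℝ)] + f) + b ∈ S) :
    (T.card : ENNReal) * ENNReal.ofReal |A.det| ≤ volume S := by
  classical
  -- the inverse matrix
  have hAunit : IsUnit A.det := isUnit_iff_ne_zero.2 hA
  have hinv : ∀ y, A.mulVec (A⁻¹.mulVec y) = y := fun y => by
    rw [Matrix.mulVec_mulVec, Matrix.mul_nonsing_inv _ hAunit, Matrix.one_mulVec]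
  -- boxes and the parallelograms as preimages
  set Box : ℤ × ℤ → Set (Fin 2 → ℝ) := fun p =>
    Set.pi Set.univ fun m : Fin 2 =>
      Ico ((![(p.1 : ℝ), (p.2 : ℝ)] : Fin 2 → ℝ) m) ((![(p.1 : ℝ), (p.2 : ℝ)] : Fin 2 → ℝ) m + 1)
    with hBox
  have hBoxvol : ∀ p, volume (Box p) = 1 := by
    intro p; rw [hBox]; simp only; rw [Real.volume_pi_Ico]; simp
  have hBoxmeas : ∀ p, MeasurableSet (Box p) := by
    intro p; rw [hBox]
    exact MeasurableSet.univ_pi fun m => measurableSet_Ico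
  set F : (Fin 2 → ℝ) → (Fin 2 → ℝ) := fun y => A⁻¹.mulVec (y - b) with hF
  have hFcont : Continuous F := by
    rw [hF]
    exact Continuous.matrix_mulVec continuous_const (continuous_id.sub continuous_const)
  set P : ℤ × ℤ → Set (Fin 2 → ℝ) := fun p => F ⁻¹' Box p with hP
  have hPmeas : ∀ p, MeasurableSet (P p) := fun p => (hBoxmeas p).preimage hFcont.measurable
  -- volume of a parallelogram
  set L : (Fin 2 → ℝ) →ₗ[ℝ] (Fin 2 → ℝ) := Matrix.toLin' A⁻¹ with hL
  have hLdet : LinearMap.det L ≠ 0 := by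
    rw [hL, LinearMap.det_toLin', Matrix.det_nonsing_inv, Ring.inverse_eq_inv]
    exact inv_ne_zero hA
  have hPvol : ∀ p, volume (P p) = ENNReal.ofReal |A.det| := by
    intro p
    have hPre : P p = (fun y => y + (-b)) ⁻¹' (L ⁻¹' Box p) := by
      ext y; simp [hP, hF, hL, Matrix.toLin'_apply, sub_eq_add_neg]
    rw [hPre, measure_preimage_add_right, MeasureTheory.Measure.addHaar_preimage_linearMap _ hLdet,
      hBoxvol, mul_one, hL, LinearMap.det_toLin', Matrix.det_nonsing_inv]
    congr 1
    rw [Ring.inverse_eq_inv, inv_inv]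
  -- pairwise disjoint
  have hdisj : Set.PairwiseDisjoint (↑T : Set (ℤ × ℤ)) P := by
    intro p _ q _ hpq
    rw [Function.onFun, Set.disjoint_left]
    intro y hyp hyq
    apply hpq
    rw [hP] at hyp hyq
    simp only [Set.mem_preimage, hBox, Set.mem_pi, Set.mem_univ, Set.mem_Ico, forall_true_left] at hyp hyq
    have h0p := hyp 0; have h0q := hyq 0; have h1p := hyp 1; have h1q := hyq 1
    simp only [Matrix.cons_val_zero, Matrix.cons_val_one] at h0p h0q h1p h1q
    have e1 : p.1 = q.1 := by
      have a1 : p.1 < q.1 + 1 := by exact_mod_cast (h0p.1.trans_lt h0q.2)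
      have a2 : q.1 < p.1 + 1 := by exact_mod_cast (h0q.1.trans_lt h0p.2)
      omega
    have e2 : p.2 = q.2 := by
      have a1 : p.2 < q.2 + 1 := by exact_mod_cast (h1p.1.trans_lt h1q.2)
      have a2 : q.2 < p.2 + 1 := by exact_mod_cast (h1q.1.trans_lt h1p.2)
      omega
    exact Prod.ext e1 e2
  -- each parallelogram lies in `S`
  have hsub : ∀ p ∈ T, P p ⊆ S := by
    intro p hp y hy
    rw [hP] at hy
    simp only [Set.mem_preimage, hBox, Set.mem_pi, Set.mem_univ, Set.mem_Ico, forall_true_left] at hy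
    set x : Fin 2 → ℝ := F y with hx
    set f : Fin 2 → ℝ := ![x 0 - p.1, x 1 - p.2] with hf
    have hx0 := hy 0; have hx1 := hy 1
    simp only [Matrix.cons_val_zero, Matrix.cons_val_one] at hx0 hx1
    have hfbox : ∀ m, 0 ≤ f m ∧ f m < 1 := by
      intro m; fin_cases m
      · simp [hf]; constructor <;> linarith [hx0.1, hx0.2]
      · simp [hf]; constructor <;> linarith [hx1.1, hx1.2]
    have hxdecomp : x = ![(p.1 : ℝ), (p.2 : ℝ)] + f := by
      funext m; fin_cases m <;> simp [hf]
    have hyx : y = A.mulVec x + b := by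
      rw [hx, hF]; simp only; rw [hinv]; abel
    rw [hyx, hxdecomp]
    exact hT p hp f hfbox
  -- measure comparison
  calc (T.card : ENNReal) * ENNReal.ofReal |A.det| = ∑ p ∈ T, ENNReal.ofReal |A.det| := by
        rw [sum_const, nsmul_eq_mul]
    _ = ∑ p ∈ T, volume (P p) := sum_congr rfl fun p _ => (hPvol p).symm
    _ = volume (⋃ p ∈ T, P p) := (measure_biUnion_finset hdisj fun p _ => hPmeas p).symm
    _ ≤ volume S := measure_mono (Set.iUnion₂_subset hsub)

/-- Real-valued form of `card_mul_det_le_volume_of_cells_subset`: if moreover `vol S ≤ V` with `V ≥ 0`,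
then `|det A| · #T ≤ V`. -/
theorem det_mul_card_le_of_cells_subset (A : Matrix (Fin 2) (Fin 2) ℝ) (hA : A.det ≠ 0)
    (b : Fin 2 → ℝ) (S : Set (Fin 2 → ℝ)) (V : ℝ) (hV : 0 ≤ V) (hSV : volume S ≤ ENNReal.ofReal V)
    (T : Finset (ℤ × ℤ))
    (hT : ∀ p ∈ T, ∀ f : Fin 2 → ℝ, (∀ m, 0 ≤ f m ∧ f m < 1) →
      A.mulVec (![(p.1 : ℝ), (p.2 : ℝ)] + f) + b ∈ S) :
    |A.det| * (T.card : ℝ) ≤ V := by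
  have hle := (card_mul_det_le_volume_of_cells_subset A hA b S T hT).trans hSV
  have hle' : ENNReal.ofReal ((T.card : ℝ) * |A.det|) ≤ ENNReal.ofReal V := by
    rw [ENNReal.ofReal_mul (Nat.cast_nonneg _), ENNReal.ofReal_natCast]
    exact hle
  have := (ENNReal.ofReal_le_ofReal_iff hV).1 hle'
  linarith

/-- **Two complementary half discs.**  For `σ ≥ 0` the closed lower half `{z₀² + z₁² ≤ σ², z₁ ≤ 0}` and the
open-sided upper half `{z₀² + z₁² ≤ σ², 0 < z₁}` of the disc of radius `σ` in `ℝ²` have total volume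
`π σ²`. -/
theorem volume_halfDiscs_add (σ : ℝ) (hσ : 0 ≤ σ) :
    volume {z : Fin 2 → ℝ | z 0 ^ 2 + z 1 ^ 2 ≤ σ ^ 2 ∧ z 1 ≤ 0} +
        volume {z : Fin 2 → ℝ | z 0 ^ 2 + z 1 ^ 2 ≤ σ ^ 2 ∧ 0 < z 1} =
      ENNReal.ofReal σ ^ 2 * ENNReal.ofReal Real.pi := by
  have hD : {z : Fin 2 → ℝ | z 0 ^ 2 + z 1 ^ 2 ≤ σ ^ 2} =
      (WithLp.toLp 2 : (Fin 2 → ℝ) → EuclideanSpace ℝ (Fin 2)) ⁻¹'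
        Metric.closedBall (0 : EuclideanSpace ℝ (Fin 2)) σ := by
    ext z
    simp only [Set.mem_setOf_eq, Set.mem_preimage, Metric.mem_closedBall, dist_zero_right,
      EuclideanSpace.norm_eq, Fin.sum_univ_two, Real.norm_eq_abs, sq_abs]
    rw [Real.sqrt_le_left hσ]
  have hDvol : volume {z : Fin 2 → ℝ | z 0 ^ 2 + z 1 ^ 2 ≤ σ ^ 2} =
      ENNReal.ofReal σ ^ 2 * ENNReal.ofReal Real.pi := by
    rw [hD, (PiLp.volume_preserving_toLp (Fin 2)).measure_preimage
      measurableSet_closedBall.nullMeasurableSet, EuclideanSpace.volume_closedBall_fin_two]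
  have hmeas : MeasurableSet {z : Fin 2 → ℝ | z 0 ^ 2 + z 1 ^ 2 ≤ σ ^ 2 ∧ 0 < z 1} := by
    have h1 : MeasurableSet {z : Fin 2 → ℝ | z 0 ^ 2 + z 1 ^ 2 ≤ σ ^ 2} :=
      measurableSet_le (by fun_prop) (by fun_prop)
    have h2 : MeasurableSet {z : Fin 2 → ℝ | 0 < z 1} :=
      measurableSet_lt (by fun_prop) (by fun_prop)
    simpa [Set.setOf_and] using h1.inter h2
  have hunion : {z : Fin 2 → ℝ | z 0 ^ 2 + z 1 ^ 2 ≤ σ ^ 2 ∧ z 1 ≤ 0} ∪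
      {z : Fin 2 → ℝ | z 0 ^ 2 + z 1 ^ 2 ≤ σ ^ 2 ∧ 0 < z 1} =
      {z : Fin 2 → ℝ | z 0 ^ 2 + z 1 ^ 2 ≤ σ ^ 2} := by
    ext z
    simp only [Set.mem_union, Set.mem_setOf_eq]
    constructor
    · rintro (⟨h, _⟩ | ⟨h, _⟩) <;> exact h
    · intro h
      rcases le_or_gt (z 1) 0 with h1 | h1
      · exact Or.inl ⟨h, h1⟩
      · exact Or.inr ⟨h, h1⟩
  have hdisj : Disjoint {z : Fin 2 → ℝ | z 0 ^ 2 + z 1 ^ 2 ≤ σ ^ 2 ∧ z 1 ≤ 0}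
      {z : Fin 2 → ℝ | z 0 ^ 2 + z 1 ^ 2 ≤ σ ^ 2 ∧ 0 < z 1} := by
    rw [Set.disjoint_left]
    rintro z ⟨_, h1⟩ ⟨_, h2⟩
    linarith
  rw [← measure_union hdisj hmeas, hunion, hDvol]

/-- **Volume of a swept ellipse.**  For `κ > 0`, `s' ≥ 0`, `ρ ≥ 0`, `R ≥ 0` and any `lo`, the union over
`h ∈ [lo, lo + R]` of the ellipses `κ² y₀² + (y₁ - h s')² ≤ κ² ρ²` (semi-axes `ρ` and `κ ρ`, centre
`(0, h s')`) has volume at most `κ π ρ² + 2 ρ R s'`. -/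
theorem volume_sweptEllipse_le (κ s' ρ lo R : ℝ) (hκ : 0 < κ) (hs' : 0 ≤ s') (hρ : 0 ≤ ρ)
    (hR : 0 ≤ R) :
    volume {y : Fin 2 → ℝ | ∃ h : ℝ, lo ≤ h ∧ h ≤ lo + R ∧
        κ ^ 2 * y 0 ^ 2 + (y 1 - h * s') ^ 2 ≤ κ ^ 2 * ρ ^ 2} ≤
      ENNReal.ofReal (κ * Real.pi * ρ ^ 2 + 2 * ρ * (R * s')) := by
  set σ : ℝ := κ * ρ with hσ
  have hσ0 : 0 ≤ σ := mul_nonneg hκ.le hρ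
  set Dm : Set (Fin 2 → ℝ) := {z | z 0 ^ 2 + z 1 ^ 2 ≤ σ ^ 2 ∧ z 1 ≤ 0} with hDm
  set Dp : Set (Fin 2 → ℝ) := {z | z 0 ^ 2 + z 1 ^ 2 ≤ σ ^ 2 ∧ 0 < z 1} with hDp
  -- the linear map `y ↦ (κ y₀, y₁)`
  set M : (Fin 2 → ℝ) →ₗ[ℝ] (Fin 2 → ℝ) := Matrix.toLin' (Matrix.diagonal ![κ, 1]) with hM
  have hM0 : ∀ y, M y 0 = κ * y 0 := by
    intro y; simp [hM, Matrix.toLin'_apply, Matrix.mulVec_diagonal]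
  have hM1 : ∀ y, M y 1 = y 1 := by
    intro y; simp [hM, Matrix.toLin'_apply, Matrix.mulVec_diagonal]
  have hMdet : LinearMap.det M = κ := by
    rw [hM, LinearMap.det_toLin', Matrix.det_diagonal]; simp
  have hMdet0 : LinearMap.det M ≠ 0 := by rw [hMdet]; exact hκ.ne'
  -- the two half ellipses and the rectangle
  set cm : Fin 2 → ℝ := ![0, lo * s'] with hcm
  set cp : Fin 2 → ℝ := ![0, (lo + R) * s'] with hcp
  set Em : Set (Fin 2 → ℝ) := (fun y => y + (-cm)) ⁻¹' (M ⁻¹' Dm) with hEm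
  set Ep : Set (Fin 2 → ℝ) := (fun y => y + (-cp)) ⁻¹' (M ⁻¹' Dp) with hEp
  set Rect : Set (Fin 2 → ℝ) := Set.Icc ![-ρ, lo * s'] ![ρ, (lo + R) * s'] with hRect
  have hEmvol : volume Em = ENNReal.ofReal |κ⁻¹| * volume Dm := by
    rw [hEm, measure_preimage_add_right, MeasureTheory.Measure.addHaar_preimage_linearMap _ hMdet0,
      hMdet]
  have hEpvol : volume Ep = ENNReal.ofReal |κ⁻¹| * volume Dp := by
    rw [hEp, measure_preimage_add_right, MeasureTheory.Measure.addHaar_preimage_linearMap _ hMdet0,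
      hMdet]
  have hEvol : volume Em + volume Ep = ENNReal.ofReal (κ * Real.pi * ρ ^ 2) := by
    rw [hEmvol, hEpvol, ← mul_add, hDm, hDp, volume_halfDiscs_add σ hσ0,
      abs_of_pos (inv_pos.2 hκ), ← ENNReal.ofReal_pow hσ0, ← ENNReal.ofReal_mul (sq_nonneg _),
      ← ENNReal.ofReal_mul (inv_pos.2 hκ).le]
    congr 1
    rw [hσ]; field_simp
  have hRectvol : volume Rect = ENNReal.ofReal (2 * ρ * (R * s')) := by
    rw [hRect, Real.volume_Icc_pi, Fin.prod_univ_two]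
    simp only [Matrix.cons_val_zero, Matrix.cons_val_one]
    rw [← ENNReal.ofReal_mul (by linarith)]
    congr 1; ring
  -- the cover
  have hcover : {y : Fin 2 → ℝ | ∃ h : ℝ, lo ≤ h ∧ h ≤ lo + R ∧
      κ ^ 2 * y 0 ^ 2 + (y 1 - h * s') ^ 2 ≤ κ ^ 2 * ρ ^ 2} ⊆ (Em ∪ Ep) ∪ Rect := by
    rintro y ⟨h, hlo, hhi, hq⟩
    have hls : lo * s' ≤ h * s' := mul_le_mul_of_nonneg_right hlo hs'
    have hhs : h * s' ≤ (lo + R) * s' := mul_le_mul_of_nonneg_right hhi hs'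
    by_cases h1 : y 1 ≤ lo * s'
    · refine Or.inl (Or.inl ?_)
      rw [hEm, Set.mem_preimage, Set.mem_preimage, hDm, Set.mem_setOf_eq, hM0, hM1]
      simp only [hcm, Pi.add_apply, Pi.neg_apply, Matrix.cons_val_zero, Matrix.cons_val_one,
        neg_zero, add_zero]
      refine ⟨?_, by linarith⟩
      rw [hσ]; nlinarith
    by_cases h2 : (lo + R) * s' < y 1
    · refine Or.inl (Or.inr ?_)
      rw [hEp, Set.mem_preimage, Set.mem_preimage, hDp, Set.mem_setOf_eq, hM0, hM1]
      simp only [hcp, Pi.add_apply, Pi.neg_apply, Matrix.cons_val_zero, Matrix.cons_val_one,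
        neg_zero, add_zero]
      refine ⟨?_, by linarith⟩
      rw [hσ]; nlinarith
    · refine Or.inr ?_
      push Not at h1 h2
      have hy0 : y 0 ^ 2 ≤ ρ ^ 2 := by
        by_contra hc
        push Not at hc
        have := mul_lt_mul_of_pos_left hc (pow_pos hκ 2)
        nlinarith
      have habs : |y 0| ≤ ρ := abs_le_of_sq_le_sq' hy0 hρ |>.2 |> fun h => abs_le.2
        ⟨(abs_le_of_sq_le_sq' hy0 hρ).1, h⟩
      rw [hRect, Set.mem_Icc, Pi.le_def, Pi.le_def]
      refine ⟨fun m => ?_, fun m => ?_⟩ <;> fin_cases m <;>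
        simp only [Fin.zero_eta, Fin.mk_one, Matrix.cons_val_zero, Matrix.cons_val_one] <;>
        first | exact (abs_le.1 habs).1 | exact (abs_le.1 habs).2 | exact h1.le | exact h2
  calc volume {y : Fin 2 → ℝ | ∃ h : ℝ, lo ≤ h ∧ h ≤ lo + R ∧
        κ ^ 2 * y 0 ^ 2 + (y 1 - h * s') ^ 2 ≤ κ ^ 2 * ρ ^ 2}
        ≤ volume ((Em ∪ Ep) ∪ Rect) := measure_mono hcover
    _ ≤ volume (Em ∪ Ep) + volume Rect := measure_union_le _ _
    _ ≤ (volume Em + volume Ep) + volume Rect := by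
        gcongr; exact measure_union_le _ _
    _ = ENNReal.ofReal (κ * Real.pi * ρ ^ 2 + 2 * ρ * (R * s')) := by
        rw [hEvol, hRectvol, ← ENNReal.ofReal_add (by positivity) (by positivity)]

/-- **Upper count for cells in a swept ellipse.**  `A` a real `2 × 2` matrix with `det A ≠ 0`,
`b : Fin 2 → ℝ`, `κ > 0`, `0 ≤ s' ≤ 1`, `ρ, R ≥ 0`, `lo` real, and `T ⊆ ℤ²` finite such that for every
`z ∈ T` and every `f ∈ [0,1)²` the point `y = A (z + f) + b` satisfies
`κ² y₀² + (y₁ - h s')² ≤ κ² ρ²` for some `h ∈ [lo, lo + R]`.  Then `|det A| · #T ≤ κ π ρ² + 2 ρ R`. -/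
theorem affine_sweptEllipse_count_upper (A : Matrix (Fin 2) (Fin 2) ℝ) (hA : A.det ≠ 0)
    (b : Fin 2 → ℝ) (κ s' ρ lo R : ℝ) (hκ : 0 < κ) (hs' : 0 ≤ s') (hs'1 : s' ≤ 1) (hρ : 0 ≤ ρ)
    (hR : 0 ≤ R) (T : Finset (ℤ × ℤ))
    (hT : ∀ p ∈ T, ∀ f : Fin 2 → ℝ, (∀ m, 0 ≤ f m ∧ f m < 1) → ∃ h : ℝ, lo ≤ h ∧ h ≤ lo + R ∧
      κ ^ 2 * (A.mulVec (![(p.1 : ℝ), (p.2 : ℝ)] + f) 0 + b 0) ^ 2 +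
        (A.mulVec (![(p.1 : ℝ), (p.2 : ℝ)] + f) 1 + b 1 - h * s') ^ 2 ≤ κ ^ 2 * ρ ^ 2) :
    |A.det| * (T.card : ℝ) ≤ κ * Real.pi * ρ ^ 2 + 2 * ρ * R := by
  have hV : 0 ≤ κ * Real.pi * ρ ^ 2 + 2 * ρ * (R * s') := by positivity
  have h1 := det_mul_card_le_of_cells_subset A hA b _ _ hV
    (volume_sweptEllipse_le κ s' ρ lo R hκ hs' hρ hR) T (fun p hp f hf => by
      simpa only [Set.mem_setOf_eq, Pi.add_apply] using hT p hp f hf)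
  have h2 : 2 * ρ * (R * s') ≤ 2 * ρ * R := by
    have : R * s' ≤ R := by nlinarith
    nlinarith
  linarith

end Summit.Ventures.Crystal3D.Theorems

end
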